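import Mathlib
import HarnessLib

/-!
# Crux `NudgeRemoval` (stmt-AtomisticToContinuum-14361), line `registered`/`birth` — one step of the reward walk

Route `route-AtomisticToContinuum-BECNudgeWalk`, sub-problem `BoseEinsteinCondensation`; helper file of the
line lead (skeleton `Cruxes/NudgeRemoval/Lines/birth.lean`, reshaped 2026-08-17). This file is the
sorry-free GLUE between the two analytic stubs of the line and the finite induction:

* `step_arith` — the real bookkeeping of one step `s ↦ t = s − ε`, `ε ≤ g/(16N)`: the clustering bound
  `η²g ≤ 8(q + ε(d′ − d))` (stub A fed with the variational comparison of `F_s` and `F_t`) and the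
  depletion bound `d′ ≤ d + Nη² + 2√V η` (stub B, `V ≤ CN`) give `d′ ≤ d + 128εCN/g + σN` once the
  near-minimiser slack `q` is small (`32q ≤ σg`, `1024Cq ≤ σ²Ng`);
* `abstract_step` — ONE STEP OF THE WALK over an abstract state type `S` with a reward family
  `F : ℝ → S → ℝ≥0∞` satisfying `F_r = F_{r′} + (r − r′)(N − n)`: clustering of near-minimisers of `F_s`
  (A-shape), the depletion increment (B-shape), the variance regime and condensation at level `β` at `s`
  give condensation at level `β + 128(s − t)C/g + σ` at every `t ∈ (0, s]` with `s − t ≤ g/(16N)`, for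
  every `σ > 0` (the `δ`'s are re-chosen: fixed `N`, everything finite);
* the `ℝ≥0∞` bookkeeping `level_of_depletion_le`, `depletion_le_of_level`, `cond_mono'`,
  `exists_le_iInf_add`, `nudged_split`.

No trial states, no integrals: the file imports only Mathlib. It is the finite-difference form of the
textbook second-order perturbation bound `−R″ ≤ 2 Var/Δ` [Kato 1966, II §6; Reed–Simon IV, XIII.1–2],
with no derivative taken.
-/

noncomputable section

open scoped ENNReal NNReal

namespace Summit.AtomisticToContinuum.BoseEinsteinCondensation.Cruxes.NudgeRemoval.Birth

/-- `η² ≤ pη + Q` with `p, Q ≥ 0` forces `η ≤ p + √Q`. -/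
theorem le_add_sqrt_of_sq_le {η p Q : ℝ} (hp : 0 ≤ p) (hQ : 0 ≤ Q)
    (h : η ^ 2 ≤ p * η + Q) : η ≤ p + Real.sqrt Q := by
  rcases le_or_gt η (p + Real.sqrt Q) with hle | hcon
  · exact hle
  exfalso
  have hsQ : 0 ≤ Real.sqrt Q := Real.sqrt_nonneg Q
  have hsq : Real.sqrt Q ^ 2 = Q := Real.sq_sqrt hQ
  have hpos : 0 < η := lt_of_le_of_lt (by positivity) hcon
  have h1 : Real.sqrt Q ≤ η := by linarith
  have h2 : η * (p + Real.sqrt Q) < η * η := mul_lt_mul_of_pos_left hcon hpos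
  have h3 : Real.sqrt Q * Real.sqrt Q ≤ η * Real.sqrt Q := mul_le_mul_of_nonneg_right h1 hsQ
  nlinarith [h2, h3, hsq]

/-- From `x² ≤ y²` and `0 ≤ y` conclude `x ≤ y`. -/
theorem le_of_sq_le_sq_aux {x y : ℝ} (hy : 0 ≤ y) (h : x ^ 2 ≤ y ^ 2) : x ≤ y := by
  rcases le_or_gt x 0 with hx | hx
  · exact hx.trans hy
  · nlinarith [h, hx, hy]

/-- **The real bookkeeping of one step of the walk.** Data: the gap `g > 0`, `N > 0`, the variance
constant `C ≥ 0`, the step `0 ≤ ε ≤ g/(16N)`, the total near-minimiser slack `q ≥ 0` (small: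
`32q ≤ σg`, `1024Cq ≤ σ²Ng`), the `L²`-distance `η` of the two near-minimisers modulo a phase, the
variance bound `V ≤ CN` and the two depletions `d` (at `s`) and `d'` (at `t = s − ε`). The clustering
bound `η²g ≤ 8(q + ε(d' − d))` and the depletion bound `d' ≤ d + Nη² + 2√V·η` give
`d' ≤ d + 128εCN/g + σN`. -/
theorem step_arith {g N C ε q η V d d' σ : ℝ} (hg : 0 < g) (hN : 0 < N) (hC : 0 ≤ C) (hε : 0 ≤ ε)
    (hεg : ε ≤ g / (16 * N)) (hq : 0 ≤ q) (hV : 0 ≤ V) (hVC : V ≤ C * N) (hσ : 0 ≤ σ)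
    (hq1 : 32 * q ≤ σ * g) (hq2 : 1024 * C * q ≤ σ ^ 2 * N * g)
    (hA : η ^ 2 * g ≤ 8 * (q + ε * (d' - d)))
    (hB : d' ≤ d + N * η ^ 2 + 2 * Real.sqrt V * η) :
    d' ≤ d + 128 * ε * C * N / g + σ * N := by
  have hmain0 : 0 ≤ 128 * ε * C * N / g := by positivity
  rcases le_or_gt d' d with hle | hlt
  · nlinarith [hle, hmain0, mul_nonneg hσ hN.le]
  set sV := Real.sqrt V with hsV_def
  have hsV : 0 ≤ sV := Real.sqrt_nonneg V
  have hsV2 : sV ^ 2 = V := Real.sq_sqrt hV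
  have hεN : ε * N ≤ g / 16 := by
    calc ε * N ≤ g / (16 * N) * N := by gcongr
      _ = g / 16 := by field_simp
  have h1 : η ^ 2 * g ≤ 8 * q + 8 * ε * (N * η ^ 2 + 2 * sV * η) := by
    have : ε * (d' - d) ≤ ε * (N * η ^ 2 + 2 * sV * η) :=
      mul_le_mul_of_nonneg_left (by linarith) hε
    linarith
  have h2 : 8 * ε * (N * η ^ 2) ≤ g * η ^ 2 / 2 := by
    have : 8 * (ε * N) * η ^ 2 ≤ 8 * (g / 16) * η ^ 2 := by gcongr
    nlinarith [this]
  have h3 : η ^ 2 * g ≤ 16 * q + 32 * ε * sV * η := by nlinarith [h1, h2]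
  set p : ℝ := 32 * ε * sV / g with hp_def
  set Q : ℝ := 16 * q / g with hQ_def
  have hp : 0 ≤ p := by positivity
  have hQ : 0 ≤ Q := by positivity
  have hpg : p * g = 32 * ε * sV := by rw [hp_def]; field_simp
  have hQg : Q * g = 16 * q := by rw [hQ_def]; field_simp
  have h4 : η ^ 2 ≤ p * η + Q := by
    have key : η ^ 2 * g ≤ (p * η + Q) * g := by
      have : (p * η + Q) * g = 16 * q + 32 * ε * sV * η := by
        calc (p * η + Q) * g = (p * g) * η + Q * g := by ring
          _ = 16 * q + 32 * ε * sV * η := by rw [hpg, hQg]; ring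
      rw [this]; exact h3
    exact le_of_mul_le_mul_right key hg
  have h5 : η ≤ p + Real.sqrt Q := le_add_sqrt_of_sq_le hp hQ h4
  have hsQ : 0 ≤ Real.sqrt Q := Real.sqrt_nonneg Q
  have hsQ2 : Real.sqrt Q ^ 2 = Q := Real.sq_sqrt hQ
  have hNp : N * p ≤ 2 * sV := by
    have key : N * p * g ≤ 2 * sV * g := by
      calc N * p * g = 32 * (ε * N) * sV := by
            calc N * p * g = N * (p * g) := by ring
              _ = 32 * (ε * N) * sV := by rw [hpg]; ring
        _ ≤ 32 * (g / 16) * sV := by gcongr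
        _ = 2 * sV * g := by ring
    exact le_of_mul_le_mul_right key hg
  have hW : N * p + 2 * sV ≤ 4 * sV := by linarith
  have hW0 : 0 ≤ N * p + 2 * sV := by positivity
  have h6 : d' - d ≤ (N * p + 2 * sV) * (p + Real.sqrt Q) + N * Q := by
    have e1 : N * η ^ 2 ≤ N * (p * η + Q) := mul_le_mul_of_nonneg_left h4 hN.le
    have e2 : (N * p + 2 * sV) * η ≤ (N * p + 2 * sV) * (p + Real.sqrt Q) :=
      mul_le_mul_of_nonneg_left h5 hW0
    nlinarith [hB, e1, e2]
  have hP1 : (N * p + 2 * sV) * p * g ≤ 128 * ε * C * N := by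
    calc (N * p + 2 * sV) * p * g = (N * p + 2 * sV) * (p * g) := by ring
      _ = (N * p + 2 * sV) * (32 * ε * sV) := by rw [hpg]
      _ ≤ (4 * sV) * (32 * ε * sV) := by gcongr
      _ = 128 * ε * V := by rw [← hsV2]; ring
      _ ≤ 128 * ε * (C * N) := by gcongr
      _ = 128 * ε * C * N := by ring
  have hP2 : (N * p + 2 * sV) * Real.sqrt Q ≤ σ * N / 2 := by
    have e3 : (N * p + 2 * sV) * Real.sqrt Q ≤ 4 * sV * Real.sqrt Q :=
      mul_le_mul_of_nonneg_right hW hsQ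
    have e4 : 4 * sV * Real.sqrt Q ≤ σ * N / 2 := by
      refine le_of_sq_le_sq_aux (by positivity) ?_
      have e5 : (4 * sV * Real.sqrt Q) ^ 2 = 16 * V * Q := by
        rw [mul_pow, mul_pow, hsQ2, hsV2]; ring
      rw [e5]
      have key : 16 * V * Q * g ≤ (σ * N / 2) ^ 2 * g := by
        calc 16 * V * Q * g = 16 * V * (Q * g) := by ring
          _ = 256 * q * V := by rw [hQg]; ring
          _ ≤ 256 * q * (C * N) := by gcongr
          _ = (1024 * C * q) * N / 4 := by ring
          _ ≤ (σ ^ 2 * N * g) * N / 4 := by gcongr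
          _ = (σ * N / 2) ^ 2 * g := by ring
      exact le_of_mul_le_mul_right key hg
    exact e3.trans e4
  have hP3 : N * Q ≤ σ * N / 2 := by
    have key : N * Q * g ≤ σ * N / 2 * g := by
      calc N * Q * g = N * (Q * g) := by ring
        _ = 16 * q * N := by rw [hQg]; ring
        _ ≤ (σ * g / 2) * N := by gcongr; linarith
        _ = σ * N / 2 * g := by ring
    exact le_of_mul_le_mul_right key hg
  have hP1' : (N * p + 2 * sV) * p ≤ 128 * ε * C * N / g := by
    rw [le_div_iff₀ hg]; exact hP1
  have h7 : d' - d ≤ 128 * ε * C * N / g + σ * N := by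
    calc d' - d ≤ (N * p + 2 * sV) * (p + Real.sqrt Q) + N * Q := h6
      _ = (N * p + 2 * sV) * p + (N * p + 2 * sV) * Real.sqrt Q + N * Q := by ring
      _ ≤ 128 * ε * C * N / g + σ * N / 2 + σ * N / 2 := by linarith [hP1', hP2, hP3]
      _ = 128 * ε * C * N / g + σ * N := by ring
  linarith

/-- Depletion `≤ βN` ⇒ condensation at level `β` (`β ≥ 0`). -/
theorem level_of_depletion_le {N : ℕ} {n : ℝ≥0∞} {β : ℝ} (hβ0 : 0 ≤ β)
    (h : (N : ℝ≥0∞) - n ≤ ENNReal.ofReal (β * N)) :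
    ENNReal.ofReal ((1 - β) * N) ≤ n := by
  by_cases hβ : β ≤ 1
  · have hsplit : (N : ℝ≥0∞) = ENNReal.ofReal ((1 - β) * N) + ENNReal.ofReal (β * N) := by
      rw [← ENNReal.ofReal_add (by nlinarith [N.cast_nonneg (α := ℝ)]) (by positivity),
        ← ENNReal.ofReal_natCast]
      congr 1; ring
    have h2 : (N : ℝ≥0∞) ≤ ENNReal.ofReal (β * N) + n := tsub_le_iff_right.1 h
    rw [hsplit, add_comm (ENNReal.ofReal (β * N)) n] at h2
    exact (ENNReal.add_le_add_iff_right ENNReal.ofReal_ne_top).1 h2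
  · have : ENNReal.ofReal ((1 - β) * N) = 0 :=
      ENNReal.ofReal_eq_zero.2 (by nlinarith [N.cast_nonneg (α := ℝ), not_le.1 hβ])
    rw [this]; exact zero_le

/-- Condensation at level `β ≥ 0` ⇒ depletion `≤ βN`. -/
theorem depletion_le_of_level {N : ℕ} {n : ℝ≥0∞} {β : ℝ} (hβ0 : 0 ≤ β)
    (h : ENNReal.ofReal ((1 - β) * N) ≤ n) :
    (N : ℝ≥0∞) - n ≤ ENNReal.ofReal (β * N) := by
  refine tsub_le_iff_right.2 ?_
  by_cases hβ : β ≤ 1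
  · have hsplit : (N : ℝ≥0∞) = ENNReal.ofReal (β * N) + ENNReal.ofReal ((1 - β) * N) := by
      rw [← ENNReal.ofReal_add (by positivity) (by nlinarith [N.cast_nonneg (α := ℝ)]),
        ← ENNReal.ofReal_natCast]
      congr 1; ring
    rw [hsplit]
    gcongr
  · calc (N : ℝ≥0∞) = ENNReal.ofReal (N : ℝ) := (ENNReal.ofReal_natCast N).symm
      _ ≤ ENNReal.ofReal (β * N) :=
          ENNReal.ofReal_le_ofReal (by nlinarith [N.cast_nonneg (α := ℝ), not_le.1 hβ])
      _ ≤ ENNReal.ofReal (β * N) + n := le_self_add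

/-- A finite infimum in `ℝ≥0∞` has `δ`-near-minimisers for every `δ > 0`. -/
theorem exists_le_iInf_add {ι : Sort*} (G : ι → ℝ≥0∞) (hG : (⨅ i, G i) ≠ ⊤) {δ : ℝ≥0∞}
    (hδ : 0 < δ) : ∃ i, G i ≤ (⨅ j, G j) + δ := by
  obtain ⟨i, hi⟩ := iInf_lt_iff.1 (ENNReal.lt_add_right hG hδ.ne')
  exact ⟨i, hi.le⟩

/-- **One step of the reward walk** over an abstract state type `S`: a reward family
`F : ℝ → S → ℝ≥0∞` with `F_r = F_{r'} + (r − r')(N − n)` (`hF`), finite infimum at `s` (`hR`),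
clustering of the near-minimisers of `F_s` modulo a phase at rate `8δ/g` (`hA`, the shape of stub A /
the Ky-Fan gap `g`), the depletion increment `N − n(Ψ') ≤ (N − n(Ψ)) + Nη² + 2√(CN)·η` for states in
the variance regime `Vb` at squared distance `≤ η²` (`hB`, the shape of stub B), the variance regime
for near-minimisers at `s` (`hVar`) and condensation at level `β` at `s` (`hCond`) give condensation
at level `β + 128(s − t)C/g + σ` at the lower reward `t`, `s − t ≤ g/(16N)`, for every `σ > 0`.
Proof: pick a reference near-minimiser `Ψ` at `s` with slack below all thresholds; a near-minimiser
`Ψ'` at `t` is a `(q + ε(d' − d))`-near-minimiser at `s` (compare `F_t(Ψ') ≤ F_t(Ψ) + δ`), so `hA`,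
`hB` and `step_arith` bound its depletion. -/
theorem abstract_step {S : Type*} (F : ℝ → S → ℝ≥0∞) (n : S → ℝ≥0∞) (ρ : S → S → ℂ → ℝ)
    (Vb : S → Prop) {N : ℕ} {s t g C β σ : ℝ}
    (hF : ∀ (r r' : ℝ) (Ψ : S), 0 ≤ r' → r' ≤ r →
      F r Ψ = F r' Ψ + ENNReal.ofReal (r - r') * ((N : ℝ≥0∞) - n Ψ))
    (hN : 0 < N) (ht : 0 < t) (hts : t ≤ s) (hg : 0 < g) (hC : 0 < C) (hβ : 0 ≤ β) (hσ : 0 < σ)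
    (hst : s - t ≤ g / (16 * N)) (hR : (⨅ Ψ, F s Ψ) ≠ ⊤)
    (hA : ∀ δ : ℝ, 0 ≤ δ → ∀ Φ Φ' : S, F s Φ ≤ (⨅ Ψ, F s Ψ) + ENNReal.ofReal δ →
        F s Φ' ≤ (⨅ Ψ, F s Ψ) + ENNReal.ofReal δ → ∃ c : ℂ, ρ Φ Φ' c ≤ 8 * δ / g)
    (hB : ∀ (Ψ Ψ' : S) (c : ℂ) (η : ℝ), 0 ≤ η → Vb Ψ → ρ Ψ' Ψ c ≤ η ^ 2 →
        (N : ℝ≥0∞) - n Ψ' ≤ ((N : ℝ≥0∞) - n Ψ) + ENNReal.ofReal (N * η ^ 2 + 2 * Real.sqrt (C * N) * η))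
    (hVar : ∃ δ : ℝ≥0∞, 0 < δ ∧ ∀ Ψ, F s Ψ ≤ (⨅ Φ, F s Φ) + δ → Vb Ψ)
    (hCond : ∃ δ : ℝ≥0∞, 0 < δ ∧ ∀ Ψ, F s Ψ ≤ (⨅ Φ, F s Φ) + δ →
        ENNReal.ofReal ((1 - β) * N) ≤ n Ψ) :
    ∃ δ : ℝ≥0∞, 0 < δ ∧ ∀ Ψ, F t Ψ ≤ (⨅ Φ, F t Φ) + δ →
      ENNReal.ofReal ((1 - (β + 128 * (s - t) * C / g + σ)) * N) ≤ n Ψ := by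
  classical
  obtain ⟨δV, hδV, hV⟩ := hVar
  obtain ⟨δC, hδC, hCd⟩ := hCond
  have hNr : (0 : ℝ) < N := Nat.cast_pos.2 hN
  set ε : ℝ := s - t with hε_def
  have hε0 : 0 ≤ ε := sub_nonneg.2 hts
  -- the slack budget of this step
  set q₀ : ℝ := min (σ * g / 32) (σ ^ 2 * N * g / (1024 * C)) with hq₀_def
  have hq₀pos : 0 < q₀ := lt_min (by positivity) (by positivity)
  have hq₀1 : 32 * q₀ ≤ σ * g := by
    have := min_le_left (σ * g / 32) (σ ^ 2 * N * g / (1024 * C)); linarith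
  have hq₀2 : 1024 * C * q₀ ≤ σ ^ 2 * N * g := by
    have h := min_le_right (σ * g / 32) (σ ^ 2 * N * g / (1024 * C))
    calc 1024 * C * q₀ ≤ 1024 * C * (σ ^ 2 * N * g / (1024 * C)) := by gcongr
      _ = σ ^ 2 * N * g := by field_simp
  -- a reference near-minimiser `Ψ` at `s`: condensed at level `β`, with the variance bound
  set δ₁ : ℝ≥0∞ := min (min δV δC) (ENNReal.ofReal (q₀ / 2)) with hδ₁_def
  have hδ₁pos : 0 < δ₁ := lt_min (lt_min hδV hδC) (ENNReal.ofReal_pos.2 (by positivity))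
  have hδ₁top : δ₁ ≠ ⊤ := ne_top_of_le_ne_top ENNReal.ofReal_ne_top (min_le_right _ _)
  obtain ⟨Ψ, hΨ⟩ := exists_le_iInf_add (fun Φ => F s Φ) hR hδ₁pos
  have hVΨ : Vb Ψ := hV Ψ (hΨ.trans (by
    gcongr; exact (min_le_left _ _).trans (min_le_left _ _)))
  have hCΨ : ENNReal.ofReal ((1 - β) * N) ≤ n Ψ := hCd Ψ (hΨ.trans (by
    gcongr; exact (min_le_left _ _).trans (min_le_right _ _)))
  have hDΨ : (N : ℝ≥0∞) - n Ψ ≤ ENNReal.ofReal (β * N) := depletion_le_of_level hβ hCΨ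
  -- the slack at the lower reward `t`
  refine ⟨ENNReal.ofReal (q₀ / 2), ENNReal.ofReal_pos.2 (by positivity), fun Ψ' hΨ' => ?_⟩
  -- depletions as real numbers
  set D : ℝ≥0∞ := (N : ℝ≥0∞) - n Ψ with hD_def
  set D' : ℝ≥0∞ := (N : ℝ≥0∞) - n Ψ' with hD'_def
  have hDle : D ≤ N := tsub_le_self
  have hD'le : D' ≤ N := tsub_le_self
  have hDtop : D ≠ ⊤ := ne_top_of_le_ne_top (ENNReal.natCast_ne_top N) hDle
  have hD'top : D' ≠ ⊤ := ne_top_of_le_ne_top (ENNReal.natCast_ne_top N) hD'le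
  set d : ℝ := D.toReal with hd_def
  set d' : ℝ := D'.toReal with hd'_def
  have hd : D = ENNReal.ofReal d := (ENNReal.ofReal_toReal hDtop).symm
  have hd' : D' = ENNReal.ofReal d' := (ENNReal.ofReal_toReal hD'top).symm
  have hd0 : 0 ≤ d := ENNReal.toReal_nonneg
  have hd'0 : 0 ≤ d' := ENNReal.toReal_nonneg
  have hdβ : d ≤ β * N := by
    have := ENNReal.toReal_mono ENNReal.ofReal_ne_top hDΨ
    rwa [ENNReal.toReal_ofReal (by positivity)] at this
  -- the target level
  have hincr : 0 ≤ 128 * ε * C / g := by positivity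
  suffices hsuff : d' ≤ (β + 128 * ε * C / g + σ) * N by
    refine level_of_depletion_le (by positivity) ?_
    change D' ≤ _
    rw [hd']
    exact ENNReal.ofReal_le_ofReal hsuff
  rcases le_or_gt d' d with hle | hlt
  · calc d' ≤ d := hle
      _ ≤ β * N := hdβ
      _ ≤ (β + 128 * ε * C / g + σ) * N := by nlinarith [hincr, hσ, hNr]
  -- main case `d < d'`: compare the functionals at `s` and `t` on `Ψ`, `Ψ'`
  have hRt : (⨅ Φ, F t Φ) ≤ F t Ψ := iInf_le _ _
  have h1 : F t Ψ' ≤ F t Ψ + ENNReal.ofReal (q₀ / 2) := hΨ'.trans (by gcongr)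
  have hsplitΨ : F s Ψ = F t Ψ + ENNReal.ofReal ε * D := hF s t Ψ ht.le hts
  have hsplitΨ' : F s Ψ' = F t Ψ' + ENNReal.ofReal ε * D' := hF s t Ψ' ht.le hts
  have h2 : F s Ψ' + ENNReal.ofReal ε * D ≤
      ((⨅ Φ, F s Φ) + δ₁) + ENNReal.ofReal (q₀ / 2) + ENNReal.ofReal ε * D' := by
    calc F s Ψ' + ENNReal.ofReal ε * D
        = F t Ψ' + ENNReal.ofReal ε * D' + ENNReal.ofReal ε * D := by rw [hsplitΨ']
      _ ≤ (F t Ψ + ENNReal.ofReal (q₀ / 2)) + ENNReal.ofReal ε * D' + ENNReal.ofReal ε * D := by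
          gcongr
      _ = (F t Ψ + ENNReal.ofReal ε * D) + ENNReal.ofReal (q₀ / 2) + ENNReal.ofReal ε * D' := by
          ring
      _ = F s Ψ + ENNReal.ofReal (q₀ / 2) + ENNReal.ofReal ε * D' := by rw [← hsplitΨ]
      _ ≤ ((⨅ Φ, F s Φ) + δ₁) + ENNReal.ofReal (q₀ / 2) + ENNReal.ofReal ε * D' := by gcongr
  -- the common real slack `δA = q + ε (d' - d)`, `q = δ₁ + q₀/2 ≤ q₀`
  set q : ℝ := δ₁.toReal + q₀ / 2 with hq_def
  have hδ₁r : δ₁ = ENNReal.ofReal δ₁.toReal := (ENNReal.ofReal_toReal hδ₁top).symm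
  have hδ₁le : δ₁.toReal ≤ q₀ / 2 := by
    have := ENNReal.toReal_mono ENNReal.ofReal_ne_top (min_le_right _ _ : δ₁ ≤ ENNReal.ofReal (q₀ / 2))
    rwa [ENNReal.toReal_ofReal (by positivity)] at this
  have hq0 : 0 ≤ q := by positivity
  have hqle : q ≤ q₀ := by linarith
  set δA : ℝ := q + ε * (d' - d) with hδA_def
  have hεdd : 0 ≤ ε * (d' - d) := mul_nonneg hε0 (by linarith)
  have hδA0 : 0 ≤ δA := by positivity
  have hkey : ENNReal.ofReal ε * D' = ENNReal.ofReal ε * D + ENNReal.ofReal (ε * (d' - d)) := by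
    rw [hd, hd', ← ENNReal.ofReal_mul hε0, ← ENNReal.ofReal_mul hε0,
      ← ENNReal.ofReal_add (by positivity) hεdd]
    congr 1; ring
  have hsum : δ₁ + ENNReal.ofReal (q₀ / 2) + ENNReal.ofReal (ε * (d' - d)) = ENNReal.ofReal δA := by
    rw [hδ₁r, ← ENNReal.ofReal_add ENNReal.toReal_nonneg (by positivity),
      ← ENNReal.ofReal_add (by positivity) hεdd]
  have h3 : F s Ψ' ≤ (⨅ Φ, F s Φ) + ENNReal.ofReal δA := by
    have hfin : ENNReal.ofReal ε * D ≠ ⊤ := ENNReal.mul_ne_top ENNReal.ofReal_ne_top hDtop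
    rw [hkey] at h2
    have h2' : F s Ψ' + ENNReal.ofReal ε * D ≤
        ((⨅ Φ, F s Φ) + ENNReal.ofReal δA) + ENNReal.ofReal ε * D := by
      calc _ ≤ _ := h2
        _ = (⨅ Φ, F s Φ) + (δ₁ + ENNReal.ofReal (q₀ / 2) + ENNReal.ofReal (ε * (d' - d))) +
              ENNReal.ofReal ε * D := by ring
        _ = ((⨅ Φ, F s Φ) + ENNReal.ofReal δA) + ENNReal.ofReal ε * D := by rw [hsum]
    exact (ENNReal.add_le_add_iff_right hfin).1 h2'
  have h4 : F s Ψ ≤ (⨅ Φ, F s Φ) + ENNReal.ofReal δA := by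
    refine hΨ.trans ?_
    gcongr
    rw [hδ₁r]
    exact ENNReal.ofReal_le_ofReal (by linarith)
  -- clustering (A) and depletion (B)
  obtain ⟨c, hc⟩ := hA δA hδA0 Ψ' Ψ h3 h4
  set ηη : ℝ := Real.sqrt (8 * δA / g) with hηη_def
  have hη0 : 0 ≤ ηη := Real.sqrt_nonneg _
  have hηsq : ηη ^ 2 = 8 * δA / g := Real.sq_sqrt (by positivity)
  have h5 := hB Ψ Ψ' c ηη hη0 hVΨ (by rw [hηsq]; exact hc)
  have h5r : d' ≤ d + (N * ηη ^ 2 + 2 * Real.sqrt (C * N) * ηη) := by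
    have hfin : D + ENNReal.ofReal (N * ηη ^ 2 + 2 * Real.sqrt (C * N) * ηη) ≠ ⊤ :=
      ENNReal.add_ne_top.2 ⟨hDtop, ENNReal.ofReal_ne_top⟩
    have := ENNReal.toReal_mono hfin h5
    rwa [ENNReal.toReal_add hDtop ENNReal.ofReal_ne_top,
      ENNReal.toReal_ofReal (by positivity)] at this
  -- the real bookkeeping
  have hAr : ηη ^ 2 * g ≤ 8 * (q + ε * (d' - d)) := by
    rw [hηsq, div_mul_cancel₀ _ hg.ne']
  have hfinal := step_arith hg hNr hC.le hε0 hst hq0 (by positivity : (0 : ℝ) ≤ C * N) le_rfl hσ.le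
    (by nlinarith [hqle, hq₀1]) (by nlinarith [hqle, hq₀2, hC]) hAr (by linarith [h5r])
  calc d' ≤ d + 128 * ε * C * N / g + σ * N := hfinal
    _ ≤ β * N + 128 * ε * C * N / g + σ * N := by linarith
    _ = (β + 128 * ε * C / g + σ) * N := by ring

/-- Monotonicity of the condensation predicate in the level (abstract state type). -/
theorem cond_mono' {S : Type*} {N : ℕ} {G n : S → ℝ≥0∞} {m : ℝ≥0∞} {β β' : ℝ}
    (h : ∃ δ : ℝ≥0∞, 0 < δ ∧ ∀ Ψ : S, G Ψ ≤ m + δ → ENNReal.ofReal ((1 - β) * N) ≤ n Ψ)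
    (hβ : β ≤ β') :
    ∃ δ : ℝ≥0∞, 0 < δ ∧ ∀ Ψ : S, G Ψ ≤ m + δ → ENNReal.ofReal ((1 - β') * N) ≤ n Ψ := by
  obtain ⟨δ, hδ, hΨ⟩ := h
  refine ⟨δ, hδ, fun Ψ hle => le_trans ?_ (hΨ Ψ hle)⟩
  exact ENNReal.ofReal_le_ofReal (by nlinarith [N.cast_nonneg (α := ℝ)])

/-- Splitting the reward: `F_r = F_{r'} + (r − r')·(N − n₀)` for `0 ≤ r' ≤ r`. -/
theorem nudged_split {N : ℕ} (E n : ℝ≥0∞) {r r' : ℝ} (hr' : 0 ≤ r') (hrr' : r' ≤ r) :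
    E + ENNReal.ofReal r * ((N : ℝ≥0∞) - n) =
      (E + ENNReal.ofReal r' * ((N : ℝ≥0∞) - n)) + ENNReal.ofReal (r - r') * ((N : ℝ≥0∞) - n) := by
  have : ENNReal.ofReal r = ENNReal.ofReal r' + ENNReal.ofReal (r - r') := by
    rw [← ENNReal.ofReal_add hr' (sub_nonneg.2 hrr')]; congr 1; ring
  rw [this, add_mul, add_assoc]

end Summit.AtomisticToContinuum.BoseEinsteinCondensation.Cruxes.NudgeRemoval.Birth

end
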